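import Summits.QuantumFields.BalabanUV.Beta.SymRootedKernelReflectionCore
import Summits.QuantumFields.BalabanUV.Beta.AveragingLinearGaugeVH

/-!
# `BalabanUV.Beta.GAN24.SymLinKernelExpansion` — binder row G-an2-4 ∕ (CONV-C), CT-W route «WC-TL» ∕ (Q-R) «QR-LL», the (S) row of RULING
# R-gan24p1-g27-1, piece (S-β) (the OWNER gan24-p1 g27's R14 (5) ∕ R15 (x): «(S-β) = the an1-COUNT identity per letter»), PART 1a: **an1's
# (0.4)-SYMMETRISED FIRST-ORDER KERNEL `q¹_sym` EXPANDED OVER BONDS, ITS EXACTNESS AT KERNEL LEVEL, ITS ROW CHARGE AND DIAGONAL COORDINATE MOMENT,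
# AND ITS TRANSVERSE SUPPORT** (G-an2-4 formalisation swarm → CRUX TEAM (2), seat `b2b-balaban-gan24-formalise-leaf-02`, gen 55)

NOT IN PRINT; OUR BOOKKEEPING ([folklore] finite-sum algebra and one universal-coefficient argument over an1's typed objects and laws BY NAME —
`SymAveragingHessianCounts{,Words,Bounds}` (`symLinCountAt`, `symLinKerAt`, `symLinU_mapForm`, `symLinU_real`, `lettersIn_axialP`, `symLinCountAt_eq_zero`),
`SymmetrisedAxialPotential.symLinAvgAt_grad`; the comb twin of §1 is leaf-01's `GAN24.ContactLambdaCommutator.linAvgAt_eq_sum_linCountAt ∕ tsum_sum_linKerAt_mul`,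
whose script §1 follows token for token; 0 `def`, 0 cited fact, 0 `def … : Prop`, 0 sorry).  HONEST FRAMING (cell contract, verbatim): «discharging `BetaPertH`
makes Bałaban's UV stability UNCONDITIONAL — a real constructive-QFT result; it is NOT the continuum limit and NOT the Clay problem.»  HONEST DEPENDENCY (verbatim):
«continuum YM on T⁴ ⇐ BetaPertH ∧ nine spine estimates (0/9 proved); BetaPertH ⇐ (D1) ∧ (D4) ∧ CAP+tail; G-an2-4 gates asym, D1 and NE2/3/4.»

WHERE THIS SITS.  The (β)-piece of the level-(j+1) first-order data of the Ward-locus residual tower (`WardResidualSRecursion.divW_WrecAt_succ_vertexForm`)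
is `vertexOfM G_{j+1} Lc (RM y) ν y′` with `RM = SymWardLettersAn1.symRMAn1 Lc cΛ` (an1's mixed Ward remainder).  At the Λ-lock its field–field
entries are `cΛ · h_sym,b((β,x),(β′,x′)) · (𝟙[w = y] − ½𝟙_{B(y)}(x) − ½𝟙_{B(y)}(x′))` (`b = (ρ′,w)`), and the two `dψ`-laws of
`GAN24.SymHessianGaugeLegContact` (ψ := a coordinate function) turn every row ∕ column sum of `h_sym,b` into the first-order kernel `q¹_sym,b` times
the COORDINATE WEIGHT `W_λ(α,x) := x_λ + (x + e_α)_λ − r_λ − (r + L•e_μ)_λ` (`r = L•y + ρ` the root).  The letter charge of `RM` is therefore a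
combination of `Σ'_x W_{β′}(β,x)·q¹(β,x)` and the two block-restricted sums `Σ'_x 𝟙_B(x)·W_{β′}(β,x)·q¹(β,x)`, `Σ'_x 𝟙_B(x)·W_β(β′,x)·q¹(β′,x)`:
this PART proves that the first vanishes on the diagonal `β = β′` (exactness); PART 1b `GAN24.SymLinKernelBlockMoments` proves that all of them vanish
off the diagonal (transverse block reflection, which needs §3 here); the consumer is `GAN24.SymRMChargeFree` ((S-β): `symRMAn1` is charge-free per letter).
* §1 `symLinAvgAt_eq_sum_symLinCountAt`, **`tsum_sum_symLinKerAt_mul`** — the symmetrised rooted averaging of ANY real 1-form expanded over bonds (box root).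
* §2 **`tsum_sum_symLinKerAt_mul_grad`** (exactness at kernel level: `Σ'_x Σ_α q¹(α,x)·(f(x+e_α) − f x) = f(r + L•e_μ) − f(r)`), `tsum_symLinKerAt_row`
  (`Σ'_x q¹(β,x) = L·[β = μ]`) and **`tsum_coordWeight_mul_symLinKerAt_diag`** (`Σ'_x W_β(β,x)·q¹(β,x) = 0`).
* §3 `lettersIn_gammaPAt_transverse`, **`symLinCountAt_eq_zero_of_transverse`** ∕ `symLinKerAt_eq_zero_of_transverse` — in every direction `α ≠ μ` the
  kernel of the coarse bond `(μ,y)` is based in the `α`-range `[L·y_α, L·y_α + L − 1]` of its own blocks (sharper than node 7a's `Near`).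
Discharges NOTHING of (S) ∕ (Q-R) ∕ (LT) ∕ (Q-L) ∕ (C) ∕ «T2Shape» ∕ «T2Drift» ∕ (hW, hWall) by itself; NEVER «G-an2-4 closed» as (CONV-C); NOT D1, NOT `BetaPertH`, NOT
continuum, NOT Clay.  2026-08-22; no existing file touched.
-/

noncomputable section

open Finset
open scoped BigOperators Nat
open Literature.MathematicalPhysics.QuantumFieldTheory.Balaban1983to89.Beta
open AffineAveraging (Form1 Site unitVec unitVec_apply box toSite)
open AveragingContours (segUp rev axial grad blk)
open AveragingContoursRooted (ctr ctrOff ctr_apply ctrOff_mem_box two_mul_half_add_one)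
open TransportedContourVariables (mapForm)
open AveragingHessianKernels (Bond δ1 δ1_apply LettersIn Hull Near lettersIn_axial mem_segUp sum_eq_zero_of_lettersIn)
open ResolventReflection (sref sref_apply bref bref_apply)
open RootedKernelReflection (fref zsgn zsgn_self zsgn_of_ne zsgn_mul_self cast_zsgn)
open Summit.QuantumFields.BalabanUV.Beta.SymmetrisedAxialPotential (symLinAvgAt symLinAvgAt_grad)
open Summit.QuantumFields.BalabanUV.Beta.SymAveragingHessianCounts
open Summit.QuantumFields.BalabanUV.Beta.SymRootedKernelReflection (symLinCountAt_fref)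
open Summit.QuantumFields.BalabanUV.Beta.LinearGaugeVH (nearBox mem_nearBox summable_of_finsupp)

namespace Summit.QuantumFields.BalabanUV.Beta.GAN24.SymLinKernelExpansion

variable {d : ℕ}

/-! ## §1 The symmetrised rooted averaging expanded over bonds (box root) -/

section Expansion

variable {L : ℕ} {r : Fin (d + 1) → ℕ}

/-- [folklore] **THE SYMMETRISED ROOTED LINEAR AVERAGING EXPANDED OVER BONDS** (box root; EVERY real 1-form `A`, no support or summability hypothesis):
`symLinAvgAt ρ A L μ y = Σ_{x ∈ nearBox L y} Σ_α symLinCountAt ρ L μ y (α, x) · A α x`.  Universal coefficients (the script of leaf-01's comb twin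
`ContactLambdaCommutator.linAvgAt_eq_sum_linCountAt`): the 1-form `U (κ, x) := [(κ, x)] ∈ (Bond →₀ ℤ)` specialises to `A` along `[f] ↦ A f`
(an1's naturality `symLinU_mapForm`), its own letter sum has coefficient `symLinCountAt … f` at `[f]`, and the coefficients vanish off the support box
(`symLinCountAt_eq_zero`). -/
theorem symLinAvgAt_eq_sum_symLinCountAt (hr : r ∈ box (d + 1) L) (A : Form1 (d + 1) ℝ) (μ : Fin (d + 1)) (y : Fin (d + 1) → ℤ) :
    symLinAvgAt (toSite r) A L μ y = ∑ x ∈ nearBox L y, ∑ α, (symLinCountAt (toSite r) L μ y (α, x) : ℝ) * A α x := by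
  classical
  let U : Form1 (d + 1) (Bond (d + 1) →₀ ℤ) := fun κ x => Finsupp.single (κ, x) 1
  let Φ : (Bond (d + 1) →₀ ℤ) →+ ℝ := Finsupp.liftAddHom fun f => zmultiplesHom ℝ (A f.1 f.2)
  have hA : mapForm Φ U = A := by
    funext κ x
    show Φ (Finsupp.single (κ, x) 1) = A κ x
    rw [Finsupp.liftAddHom_apply_single, zmultiplesHom_apply, one_zsmul]
  -- the symmetrised letter sum of the universal form
  have hcoef : ∀ f : Bond (d + 1),
      (∑ σ : Equiv.Perm (Fin (d + 1)), ∑ b ∈ box (d + 1) L, (gammaPAt σ σ (toSite r) U L μ y b).sum) f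
        = symLinCountAt (toSite r) L μ y f := by
    intro f
    have hUf : mapForm (Finsupp.applyAddHom f) U = δ1 f := by
      funext κ x
      show (Finsupp.single (κ, x) (1 : ℤ)) f = δ1 f κ x
      rw [Finsupp.single_apply, δ1_apply]
    have h := symLinU_mapForm (Finsupp.applyAddHom f) (toSite r) U L μ y
    rw [hUf, Finsupp.applyAddHom_apply] at h
    rw [← h]
    rfl
  have h1 : symLinAvgAt (toSite r) A L μ y
      = Φ (∑ σ : Equiv.Perm (Fin (d + 1)), ∑ b ∈ box (d + 1) L, (gammaPAt σ σ (toSite r) U L μ y b).sum) := by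
    rw [← symLinU_real, ← hA, symLinU, symLinU_mapForm]
  rw [h1, Finsupp.liftAddHom_apply, Finsupp.sum]
  have hsupp : (∑ σ : Equiv.Perm (Fin (d + 1)), ∑ b ∈ box (d + 1) L, (gammaPAt σ σ (toSite r) U L μ y b).sum).support
      ⊆ (Finset.univ : Finset (Fin (d + 1))) ×ˢ nearBox L y := by
    intro f hf
    rw [Finsupp.mem_support_iff, hcoef] at hf
    rw [Finset.mem_product]
    refine ⟨Finset.mem_univ _, mem_nearBox.2 ?_⟩
    by_contra hn
    exact hf (symLinCountAt_eq_zero hr hn)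
  rw [Finset.sum_subset hsupp, Finset.sum_product_right]
  · refine Finset.sum_congr rfl fun x _ => Finset.sum_congr rfl fun α _ => ?_
    rw [zmultiplesHom_apply, hcoef, zsmul_eq_mul]
  · intro f _ hf
    rw [Finsupp.notMem_support_iff.1 hf, map_zero]

/-- [folklore] SUPPORT (box root): `q¹_sym,(μ,y)(α, x) = 0` for `x ∉ nearBox L y`. -/
theorem symLinKerAt_eq_zero_of_not_mem (hr : r ∈ box (d + 1) L) (μ : Fin (d + 1)) {y x : Fin (d + 1) → ℤ} (hx : x ∉ nearBox L y)
    (α : Fin (d + 1)) : symLinKerAt (toSite r) L μ y (α, x) = 0 :=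
  symLinKerAt_eq_zero hr (f := (α, x)) fun h => hx (mem_nearBox.2 h)

/-- [folklore] The `q¹_sym`-pairing integrand vanishes off the support box. -/
theorem sum_symLinKerAt_mul_eq_zero_of_not_mem (hr : r ∈ box (d + 1) L) (A : Form1 (d + 1) ℝ) (μ : Fin (d + 1)) {y x : Fin (d + 1) → ℤ}
    (hx : x ∉ nearBox L y) : ∑ α, symLinKerAt (toSite r) L μ y (α, x) * A α x = 0 :=
  Finset.sum_eq_zero fun α _ => by rw [symLinKerAt_eq_zero_of_not_mem hr μ hx α, zero_mul]

/-- [folklore] The `q¹_sym`-pairing integrand is summable (finitely supported). -/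
theorem summable_sum_symLinKerAt_mul (hr : r ∈ box (d + 1) L) (A : Form1 (d + 1) ℝ) (μ : Fin (d + 1)) (y : Fin (d + 1) → ℤ) :
    Summable fun x => ∑ α, symLinKerAt (toSite r) L μ y (α, x) * A α x :=
  summable_of_finsupp (nearBox L y) fun _ hx => sum_symLinKerAt_mul_eq_zero_of_not_mem hr A μ hx

/-- [folklore] **THE `q¹_sym`-PAIRING OF A 1-FORM IS ITS SYMMETRISED ROOTED AVERAGE** (box root; every real 1-form `A`):
`Σ'_x Σ_α q¹_sym,(μ,y)(α, x) · A α x = ((d+1)!·L^{d+1})⁻¹ · symLinAvgAt ρ A L μ y`. -/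
theorem tsum_sum_symLinKerAt_mul (hr : r ∈ box (d + 1) L) (A : Form1 (d + 1) ℝ) (μ : Fin (d + 1)) (y : Fin (d + 1) → ℤ) :
    ∑' x, ∑ α, symLinKerAt (toSite r) L μ y (α, x) * A α x
      = ((((d + 1).factorial : ℕ) : ℝ) * (L : ℝ) ^ (d + 1))⁻¹ * symLinAvgAt (toSite r) A L μ y := by
  classical
  rw [tsum_eq_sum (s := nearBox L y) (fun _ hx => sum_symLinKerAt_mul_eq_zero_of_not_mem hr A μ hx),
    symLinAvgAt_eq_sum_symLinCountAt hr A μ y, Finset.mul_sum]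
  refine Finset.sum_congr rfl fun x _ => ?_
  rw [Finset.mul_sum]
  refine Finset.sum_congr rfl fun α _ => ?_
  rw [symLinKerAt, div_eq_inv_mul, mul_assoc]

end Expansion

/-! ## §2 Exactness at kernel level, the row charge, and the diagonal coordinate moment -/

section Exactness

variable {L : ℕ} {r : Fin (d + 1) → ℕ}

/-- [folklore] **EXACTNESS AT KERNEL LEVEL** (box root, `1 ≤ L`): `Σ'_x Σ_α q¹_sym,(μ,y)(α, x) · (f(x + e_α) − f x) = f(r_b + L•e_μ) − f(r_b)`, `r_b = L•y + ρ`
— an1's `symLinAvgAt_grad` (the symmetrised averaging of an exact form sees `f` only at the two roots) through §1. -/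
theorem tsum_sum_symLinKerAt_mul_grad (hL : 1 ≤ L) (hr : r ∈ box (d + 1) L) (f : (Fin (d + 1) → ℤ) → ℝ) (μ : Fin (d + 1))
    (y : Fin (d + 1) → ℤ) :
    ∑' x, ∑ α, symLinKerAt (toSite r) L μ y (α, x) * (f (x + unitVec α) - f x)
      = f ((L : ℤ) • y + toSite r + (L : ℤ) • unitVec μ) - f ((L : ℤ) • y + toSite r) := by
  have hL' : (L : ℝ) ≠ 0 := by exact_mod_cast (show L ≠ 0 by omega)
  have hd : (((d + 1).factorial : ℕ) : ℝ) ≠ 0 := by exact_mod_cast Nat.factorial_ne_zero (d + 1)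
  have h := tsum_sum_symLinKerAt_mul hr (grad f) μ y
  simp only [AveragingContours.grad] at h
  rw [h, symLinAvgAt_grad, card_box]
  push_cast
  field_simp

/-- [folklore] **THE ROW CHARGE OF `q¹_sym`**: `Σ'_x q¹_sym,(μ,y)(β, x) = L·[μ = β]` (exactness with the coordinate function `x ↦ x_β`). -/
theorem tsum_symLinKerAt_row (hL : 1 ≤ L) (hr : r ∈ box (d + 1) L) (μ β : Fin (d + 1)) (y : Fin (d + 1) → ℤ) :
    ∑' x, symLinKerAt (toSite r) L μ y (β, x) = if β = μ then (L : ℝ) else 0 := by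
  have h := tsum_sum_symLinKerAt_mul_grad hL hr (fun z => ((z β : ℤ) : ℝ)) μ y
  have hpt : ∀ x : Fin (d + 1) → ℤ,
      ∑ α, symLinKerAt (toSite r) L μ y (α, x) * ((((x + unitVec α) β : ℤ) : ℝ) - ((x β : ℤ) : ℝ))
        = symLinKerAt (toSite r) L μ y (β, x) := by
    intro x
    rw [Finset.sum_eq_single β]
    · simp
    · intro α _ hα
      have : ((x + unitVec α) β : ℤ) = x β := by simp [Ne.symm hα]
      rw [this, sub_self, mul_zero]
    · exact fun h => absurd (Finset.mem_univ β) h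
  simp only [hpt] at h
  rw [h]
  simp only [Pi.add_apply, Pi.smul_apply, smul_eq_mul, unitVec_apply, mul_ite, mul_one, mul_zero]
  split_ifs <;> push_cast <;> ring

/-- [folklore] **(b) THE DIAGONAL COORDINATE MOMENT VANISHES**: with the root `r_b = L•y + ρ` and `W_β(β,x) = x_β + (x+e_β)_β − (r_b)_β − (r_b + L•e_μ)_β`,
`Σ'_x W_β(β,x) · q¹_sym,(μ,y)(β, x) = 0` — exactness with `f = (x_β − (r_b)_β)²` gives `Σ'_x (2(x−r_b)_β + 1)·q¹(β,x) = L²[μ=β]`, and the row charge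
gives `Σ'_x q¹(β,x) = L[μ=β]`. -/
theorem tsum_coordWeight_mul_symLinKerAt_diag (hL : 1 ≤ L) (hr : r ∈ box (d + 1) L) (μ β : Fin (d + 1)) (y : Fin (d + 1) → ℤ) :
    ∑' x, (((x β : ℤ) : ℝ) + (((x + unitVec β) β : ℤ) : ℝ) - ((((L : ℤ) • y + toSite r) β : ℤ) : ℝ)
        - ((((L : ℤ) • y + toSite r + (L : ℤ) • unitVec μ) β : ℤ) : ℝ)) * symLinKerAt (toSite r) L μ y (β, x) = 0 := by
  -- exactness with the squared coordinate
  set c : ℝ := ((((L : ℤ) • y + toSite r) β : ℤ) : ℝ) with hc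
  have h2 := tsum_sum_symLinKerAt_mul_grad hL hr (fun z => (((z β : ℤ) : ℝ) - c) ^ 2) μ y
  have hpt : ∀ x : Fin (d + 1) → ℤ,
      ∑ α, symLinKerAt (toSite r) L μ y (α, x) * (((((x + unitVec α) β : ℤ) : ℝ) - c) ^ 2 - ((((x β : ℤ) : ℝ)) - c) ^ 2)
        = (2 * (((x β : ℤ) : ℝ) - c) + 1) * symLinKerAt (toSite r) L μ y (β, x) := by
    intro x
    rw [Finset.sum_eq_single β]
    · have : (((x + unitVec β) β : ℤ) : ℝ) = ((x β : ℤ) : ℝ) + 1 := by push_cast [Pi.add_apply, unitVec_apply]; simp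
      rw [this]; ring
    · intro α _ hα
      have : ((x + unitVec α) β : ℤ) = x β := by simp [Ne.symm hα]
      rw [this, sub_self, mul_zero]
    · exact fun h => absurd (Finset.mem_univ β) h
  simp only [hpt] at h2
  have h1 := tsum_symLinKerAt_row hL hr μ β y
  -- summability of the two pieces (finite support)
  have hs0 : Summable fun x => symLinKerAt (toSite r) L μ y (β, x) :=
    summable_of_finsupp (nearBox L y) fun x hx => symLinKerAt_eq_zero_of_not_mem hr μ hx β
  have hs1 : Summable fun x => (2 * (((x β : ℤ) : ℝ) - c) + 1) * symLinKerAt (toSite r) L μ y (β, x) :=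
    summable_of_finsupp (nearBox L y) fun x hx => by rw [symLinKerAt_eq_zero_of_not_mem hr μ hx β, mul_zero]
  have key : ∀ x : Fin (d + 1) → ℤ,
      (((x β : ℤ) : ℝ) + (((x + unitVec β) β : ℤ) : ℝ) - c - ((((L : ℤ) • y + toSite r + (L : ℤ) • unitVec μ) β : ℤ) : ℝ))
          * symLinKerAt (toSite r) L μ y (β, x)
        = (2 * (((x β : ℤ) : ℝ) - c) + 1) * symLinKerAt (toSite r) L μ y (β, x)
          - (if β = μ then (L : ℝ) else 0) * symLinKerAt (toSite r) L μ y (β, x) := by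
    intro x
    have e1 : (((x + unitVec β) β : ℤ) : ℝ) = ((x β : ℤ) : ℝ) + 1 := by push_cast [Pi.add_apply, unitVec_apply]; simp
    have e2 : ((((L : ℤ) • y + toSite r + (L : ℤ) • unitVec μ) β : ℤ) : ℝ) = c + (if β = μ then (L : ℝ) else 0) := by
      rw [hc]; simp only [Pi.add_apply, Pi.smul_apply, smul_eq_mul, unitVec_apply, mul_ite, mul_one, mul_zero]
      split_ifs <;> push_cast <;> ring
    rw [e1, e2]; ring
  rw [tsum_congr key, hs1.tsum_sub (hs0.mul_left _), tsum_mul_left, h2, h1, hc]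
  simp only [Pi.add_apply, Pi.smul_apply, smul_eq_mul, unitVec_apply, mul_ite, mul_one, mul_zero]
  split_ifs <;> push_cast <;> ring

end Exactness

/-! ## §3 Transverse support: in every direction `α ≠ μ` the kernel of the bond `(μ,y)` lives in the `α`-range of its own blocks -/

section Support

variable {R : Type*} [AddCommGroup R]

/-- [folklore] **TRANSVERSE LETTERS** (box root): every letter of the pair word `γ^{σ,σ′}_x`, `x ∈ B(y)`, is a bond whose base point has, in EVERY
direction `i ≠ μ`, its `i`-coordinate in `[L·y_i, L·y_i + L − 1]` (the two combs live in the coordinatewise hulls of root and block point, the straight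
piece moves only the `μ`-coordinate) — sharper than node 7a's `Near` (`≤ L·y_i + 2L − 1`), which is attained only in the direction `μ`. -/
theorem lettersIn_gammaPAt_transverse (σ σ' : Equiv.Perm (Fin (d + 1))) (A : Form1 (d + 1) R) (L : ℕ) (μ : Fin (d + 1))
    (y : Fin (d + 1) → ℤ) {r b : Fin (d + 1) → ℕ} (hr : r ∈ box (d + 1) L) (hb : b ∈ box (d + 1) L) :
    LettersIn A (fun x' => ∀ i, i ≠ μ → (L : ℤ) * y i ≤ x' i ∧ x' i ≤ (L : ℤ) * y i + (L - 1))
      (gammaPAt σ σ' (toSite r) A L μ y b) := by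
  have hr' : ∀ i, r i < L := by simpa [AffineAveraging.box, Fintype.mem_piFinset, Finset.mem_range] using hr
  have hb' : ∀ i, b i < L := by simpa [AffineAveraging.box, Fintype.mem_piFinset, Finset.mem_range] using hb
  refine LettersIn.append (LettersIn.append ?_ ?_) ?_
  · refine (lettersIn_axialP σ A _ _).mono fun x' hx' i hi => ?_
    obtain ⟨h1, h2⟩ := hx' i
    have hbi := hb' i; have hri := hr' i
    simp only [Pi.add_apply, Pi.smul_apply, smul_eq_mul, toSite] at h1 h2
    rw [min_le_iff] at h1; rw [le_max_iff] at h2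
    constructor <;> omega
  · intro a ha
    obtain ⟨s, hs', rfl⟩ := mem_segUp ha
    refine ⟨μ, _, fun i hi => ?_, Or.inl rfl⟩
    have hbi := hb' i
    simp only [Pi.add_apply, Pi.smul_apply, smul_eq_mul, toSite, unitVec_apply, if_neg hi, mul_zero, add_zero]
    constructor <;> omega
  · refine (lettersIn_axialP σ' A _ _).rev.mono fun x' hx' i hi => ?_
    obtain ⟨h1, h2⟩ := hx' i
    have hbi := hb' i; have hri := hr' i
    simp only [Pi.add_apply, Pi.smul_apply, smul_eq_mul, toSite, unitVec_apply, if_neg hi, mul_zero, add_zero] at h1 h2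
    rw [min_le_iff] at h1; rw [le_max_iff] at h2
    constructor <;> omega

/-- [folklore] **TRANSVERSE SUPPORT OF `symLinCountAt`** (box root): for `α ≠ μ` the count of the coarse bond `(μ, y)` vanishes at every fine bond whose
base point has its `α`-coordinate outside `[L·y_α, L·y_α + L − 1]`. -/
theorem symLinCountAt_eq_zero_of_transverse {L : ℕ} {μ : Fin (d + 1)} {y : Fin (d + 1) → ℤ} {r : Fin (d + 1) → ℕ} (hr : r ∈ box (d + 1) L)
    {α : Fin (d + 1)} (hα : α ≠ μ) {f : Bond (d + 1)} (h : ¬ ((L : ℤ) * y α ≤ f.2 α ∧ f.2 α ≤ (L : ℤ) * y α + (L - 1))) :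
    symLinCountAt (toSite r) L μ y f = 0 :=
  Finset.sum_eq_zero fun σ _ => Finset.sum_eq_zero fun _ hb =>
    sum_eq_zero_of_lettersIn (P := fun x' => ∀ i, i ≠ μ → (L : ℤ) * y i ≤ x' i ∧ x' i ≤ (L : ℤ) * y i + (L - 1))
      (fun hP => h (hP α hα)) (lettersIn_gammaPAt_transverse σ σ _ L μ y hr hb)

/-- [folklore] The same for the real kernel `q¹_sym`. -/
theorem symLinKerAt_eq_zero_of_transverse {L : ℕ} {μ : Fin (d + 1)} {y : Fin (d + 1) → ℤ} {r : Fin (d + 1) → ℕ} (hr : r ∈ box (d + 1) L)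
    {α : Fin (d + 1)} (hα : α ≠ μ) {κ : Fin (d + 1)} {x : Fin (d + 1) → ℤ}
    (h : ¬ ((L : ℤ) * y α ≤ x α ∧ x α ≤ (L : ℤ) * y α + (L - 1))) :
    symLinKerAt (toSite r) L μ y (κ, x) = 0 := by
  rw [symLinKerAt, symLinCountAt_eq_zero_of_transverse hr hα (f := (κ, x)) h, Int.cast_zero, zero_div]

end Support

end Summit.QuantumFields.BalabanUV.Beta.GAN24.SymLinKernelExpansion

end
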